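import Literature.MathematicalPhysics.QuantumLattice.BCSPairEtaSpinAlgebra
import Literature.MathematicalPhysics.QuantumLattice.KomaPiFluxThermalTwoPointBound
import HarnessLib

/-!
# The double commutator of the pair interaction with `Γ¹_x` (Koma 2022, (6.27)–(6.29), local form)

T. Koma, *Nambu–Goldstone modes for superconducting lattice fermions*, arXiv:2201.13135 (2022)
[Koma2022], §6: the Falk–Bruch bound (6.16) (`KomaPiFlux.gibbs_modes_le`) involves the double
commutator `c_p = ⟨[Γ̂¹_{-p}, [H, Γ̂¹_p]]⟩`, and the sum rule needs only `|Λ|⁻¹Σ_p c_p`, i.e. (Plancherel)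
the LOCAL double commutators `Σ_x ⟨[Γ¹_x, [H, Γ¹_x]]⟩`. Koma computes the interaction part in
(6.27)–(6.29) with the `η`-spin algebra (3.8)–(3.10): `[H_int, Γ̂¹_p] = -ig|Λ|^{-1/2}Σ e^{-ipx}Γ³_x(Γ²_{x+e_m} + Γ²_{x-e_m})`
and `|Λ|⁻¹Σ_p⟨[Γ̂¹_{-p},[H_int,Γ̂¹_p]]⟩ = -2g|Λ|⁻¹Σ_xΣ_m⟨Γ²_xΓ²_{x+e_m} + Γ²_xΓ²_{x-e_m}⟩`.

This file proves the corresponding OPERATOR identities on a general graph, for the pair-hopping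
Hamiltonian of the tree (`PairHopRP.hamiltonian G T U g h B`, Lieb frame, ferromagnetic `η` sign —
hence the opposite overall sign of the `Γ²Γ²` term compared with Koma's antiferromagnetic frame,
cf. (6.5)):

* the Pauli-type products of the `η`-spin operators at one site (`Γ⁺Γ³ = Γ⁺`, `Γ³Γ⁺ = -Γ⁺`,
  `Γ¹Γ² = iΓ³`, `Γ¹Γ³ = -iΓ²`, `Γ²Γ³ = iΓ¹`, …), sharpening (3.8)–(3.10);
* `PairHopRP.pairInteraction_comm_gammaOne` — `[H_pair(g,0), Γ¹_x] = ig Σ_{y∼x} Γ³_xΓ²_y` ((6.27));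
* `PairHopRP.gammaOne_doubleComm_pairInteraction` — `[Γ¹_x, [H_pair(g,0), Γ¹_x]] = 2g Σ_{y∼x} Γ²_xΓ²_y`
  ((6.28)–(6.29), local form);
* `PairHopRP.hubbardU_comm_gammaOne` — the on-site `U` term commutes with `Γ¹_x` (Koma's model has it
  inside `H_int`, (3.7)); `PairHopRP.gammaOne_doubleComm_orderParameter` — `[Γ¹_x,[O,Γ¹_x]] = -4Γ²_x`;
* `PairHopRP.gammaOne_doubleComm_hamiltonian` — for `H = K(T) + UΣ(n-½)(n-½) + H_pair(g,0) - B·O`: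
  `[Γ¹_x,[H,Γ¹_x]] = [Γ¹_x,[K(T),Γ¹_x]] + 2gΣ_{y∼x}Γ²_xΓ²_y + 4BΓ²_x` — the hopping part `[Γ¹,[K,Γ¹]]`
  (Koma's (6.26), `‖·‖ ≤ 8d|κ|`) is left symbolic here.

All statements are PROVED from the CAR identities; no named fact.

## References

* [Koma2022] T. Koma, arXiv:2201.13135, (3.7)–(3.10), (6.25)–(6.29).
-/

noncomputable section

namespace Literature.MathematicalPhysics.QuantumLattice

open Matrix Finset HubbardWave0

namespace PairHopRP

variable {Λ : Type*} [LinearOrder Λ] [Fintype Λ]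

/-! ### Pauli-type products at one site -/

/-- `Γ⁺_x n_{xσ} = 0` (after creating the pair both orbitals are occupied … read from the right:
`n_{xσ}` followed by creating into the orbital `xσ` vanishes). [cite: Koma2022, (3.7)–(3.9)] -/
theorem gammaPlus_mul_numberOp (x : Λ) (σ : Fin 2) : gammaPlus x * numberOp x σ = 0 := by
  have hσ : σ = 0 ∨ σ = 1 := by fin_cases σ <;> simp
  unfold gammaPlus numberOp
  rcases hσ with rfl | rfl
  · rw [creation_mul_creation_eq_neg, Matrix.neg_mul, Matrix.mul_assoc, ← Matrix.mul_assoc (creation (orb x 0)),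
      creation_mul_self, Matrix.zero_mul, Matrix.mul_zero, neg_zero]
  · rw [Matrix.mul_assoc, ← Matrix.mul_assoc (creation (orb x 1)), creation_mul_self, Matrix.zero_mul,
      Matrix.mul_zero]

/-- `n_{xσ} Γ⁻_x = 0`. [cite: Koma2022, (3.7)–(3.9)] -/
theorem numberOp_mul_gammaMinus (x : Λ) (σ : Fin 2) : numberOp x σ * gammaMinus x = 0 := by
  have h := congrArg conjTranspose (gammaPlus_mul_numberOp x σ)
  rw [conjTranspose_mul, conjTranspose_gammaPlus, conjTranspose_zero] at h
  have hn : (numberOp x σ)ᴴ = numberOp x σ := by rw [numberOp]; exact (numberAt_isHermitian (orb x σ)).eq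
  rwa [hn] at h

/-- `n_{xσ} Γ⁺_x = Γ⁺_x`. [cite: Koma2022, (3.7)–(3.9)] -/
theorem numberOp_mul_gammaPlus (x : Λ) (σ : Fin 2) : numberOp x σ * gammaPlus x = gammaPlus x := by
  have h := numberOp_comm_gammaPlus x x σ
  rw [if_pos rfl, gammaPlus_mul_numberOp, sub_zero] at h
  exact h

/-- `Γ⁻_x n_{xσ} = Γ⁻_x`. [cite: Koma2022, (3.7)–(3.9)] -/
theorem gammaMinus_mul_numberOp (x : Λ) (σ : Fin 2) : gammaMinus x * numberOp x σ = gammaMinus x := by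
  have h := numberOp_comm_gammaMinus x x σ
  rw [if_pos rfl, numberOp_mul_gammaMinus, zero_sub, neg_inj] at h
  exact h

/-- `Γ⁺_x Γ³_x = Γ⁺_x`. [cite: Koma2022, (3.9)–(3.10)] -/
theorem gammaPlus_mul_gammaThree (x : Λ) : gammaPlus x * gammaThree x = gammaPlus x := by
  rw [gammaThree, Matrix.mul_sub, Matrix.mul_sub, Matrix.mul_one, gammaPlus_mul_numberOp, gammaPlus_mul_numberOp,
    sub_zero, sub_zero]

/-- `Γ³_x Γ⁺_x = -Γ⁺_x`. [cite: Koma2022, (3.9)–(3.10)] -/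
theorem gammaThree_mul_gammaPlus (x : Λ) : gammaThree x * gammaPlus x = -gammaPlus x := by
  rw [gammaThree, Matrix.sub_mul, Matrix.sub_mul, Matrix.one_mul, numberOp_mul_gammaPlus, numberOp_mul_gammaPlus,
    sub_self, zero_sub]

/-- `Γ³_x Γ⁻_x = Γ⁻_x`. [cite: Koma2022, (3.9)–(3.10)] -/
theorem gammaThree_mul_gammaMinus (x : Λ) : gammaThree x * gammaMinus x = gammaMinus x := by
  rw [gammaThree, Matrix.sub_mul, Matrix.sub_mul, Matrix.one_mul, numberOp_mul_gammaMinus, numberOp_mul_gammaMinus,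
    sub_zero, sub_zero]

/-- `Γ⁻_x Γ³_x = -Γ⁻_x`. [cite: Koma2022, (3.9)–(3.10)] -/
theorem gammaMinus_mul_gammaThree (x : Λ) : gammaMinus x * gammaThree x = -gammaMinus x := by
  rw [gammaThree, Matrix.mul_sub, Matrix.mul_sub, Matrix.mul_one, gammaMinus_mul_numberOp, gammaMinus_mul_numberOp,
    sub_self, zero_sub]

/-- `Γ¹_x Γ³_x = -iΓ²_x`. [cite: Koma2022, (3.10)] -/
theorem gammaOne_mul_gammaThree (x : Λ) : gammaOne x * gammaThree x = -Complex.I • gammaTwo x := by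
  rw [gammaOne, Matrix.add_mul, gammaPlus_mul_gammaThree, gammaMinus_mul_gammaThree, gammaTwo, smul_smul,
    show -Complex.I * Complex.I = 1 by rw [neg_mul, Complex.I_mul_I, neg_neg], one_smul]
  abel

/-- `Γ³_x Γ¹_x = iΓ²_x`. [cite: Koma2022, (3.10)] -/
theorem gammaThree_mul_gammaOne (x : Λ) : gammaThree x * gammaOne x = Complex.I • gammaTwo x := by
  rw [gammaOne, Matrix.mul_add, gammaThree_mul_gammaPlus, gammaThree_mul_gammaMinus, gammaTwo, smul_smul,
    Complex.I_mul_I, neg_one_smul, neg_sub]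
  abel

/-- `Γ²_x Γ³_x = iΓ¹_x`. [cite: Koma2022, (3.10)] -/
theorem gammaTwo_mul_gammaThree (x : Λ) : gammaTwo x * gammaThree x = Complex.I • gammaOne x := by
  rw [gammaTwo, Matrix.smul_mul, Matrix.sub_mul, gammaPlus_mul_gammaThree, gammaMinus_mul_gammaThree, gammaOne,
    sub_neg_eq_add]

/-- `Γ³_x Γ²_x = -iΓ¹_x`. [cite: Koma2022, (3.10)] -/
theorem gammaThree_mul_gammaTwo (x : Λ) : gammaThree x * gammaTwo x = -Complex.I • gammaOne x := by
  rw [gammaTwo, Matrix.mul_smul, Matrix.mul_sub, gammaThree_mul_gammaPlus, gammaThree_mul_gammaMinus, gammaOne]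
  module

/-- `Γ¹_x Γ²_x = iΓ³_x`. [cite: Koma2022, (3.8)] -/
theorem gammaOne_mul_gammaTwo (x : Λ) : gammaOne x * gammaTwo x = Complex.I • gammaThree x := by
  rw [← gammaMinus_mul_gammaPlus_sub, gammaOne, gammaTwo, Matrix.mul_smul, Matrix.add_mul, Matrix.mul_sub,
    Matrix.mul_sub, gammaPlus_mul_self, gammaMinus_mul_self]
  module

/-- `Γ²_x Γ¹_x = -iΓ³_x`. [cite: Koma2022, (3.8)] -/
theorem gammaTwo_mul_gammaOne (x : Λ) : gammaTwo x * gammaOne x = -Complex.I • gammaThree x := by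
  rw [← gammaMinus_mul_gammaPlus_sub, gammaOne, gammaTwo, Matrix.smul_mul, Matrix.sub_mul, Matrix.mul_add,
    Matrix.mul_add, gammaPlus_mul_self, gammaMinus_mul_self]
  module

/-! ### Commutation at different sites -/

/-- `Γ³_y Γ¹_x = Γ¹_x Γ³_y` for `y ≠ x`. [cite: Koma2022, §3] -/
theorem gammaThree_comm_gammaOne_of_ne {x y : Λ} (hxy : y ≠ x) :
    gammaThree y * gammaOne x = gammaOne x * gammaThree y := by
  rw [gammaOne, Matrix.mul_add, Matrix.add_mul, gammaThree_comm_gammaPlus_of_ne hxy, gammaThree_comm_gammaMinus_of_ne hxy]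

/-- `Γ³_y Γ²_x = Γ²_x Γ³_y` for `y ≠ x`. [cite: Koma2022, §3] -/
theorem gammaThree_comm_gammaTwo_of_ne {x y : Λ} (hxy : y ≠ x) :
    gammaThree y * gammaTwo x = gammaTwo x * gammaThree y := by
  rw [gammaTwo, Matrix.mul_smul, Matrix.smul_mul, Matrix.mul_sub, Matrix.sub_mul, gammaThree_comm_gammaPlus_of_ne hxy,
    gammaThree_comm_gammaMinus_of_ne hxy]

/-! ### `[H_pair(g,0), Γ¹_x]` and the double commutator -/

section Graph

variable (G : SimpleGraph Λ) [DecidableRel G.Adj]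

/-- Bookkeeping: a double sum whose terms vanish off the "cross" `{a = x} ∪ {b = x}` and at `(x,x)`
is the sum over the cross. [folklore] -/
private theorem sum_sum_eq_cross {M : Type*} [AddCommMonoid M] (C : Λ → Λ → M) (x : Λ)
    (h0 : ∀ a b, a ≠ x → b ≠ x → C a b = 0) (hxx : C x x = 0) :
    ∑ a, ∑ b, C a b = ∑ y, (C x y + C y x) := by
  rw [Finset.sum_add_distrib, ← Finset.add_sum_erase _ _ (Finset.mem_univ x)]
  congr 1
  rw [← Finset.add_sum_erase univ (fun a => C a x) (Finset.mem_univ x), hxx, zero_add]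
  refine Finset.sum_congr rfl fun a ha => ?_
  have hax : a ≠ x := Finset.ne_of_mem_erase ha
  exact Finset.sum_eq_single x (fun b _ hb => h0 a b hax hb) (fun h => absurd (Finset.mem_univ x) h)

/-- `Γ¹_x` commutes with the bond terms of bonds not containing `x`. [cite: Koma2022, (6.27)] -/
theorem commute_gammaOne_bondTerm {x a b : Λ} (ha : a ≠ x) (hb : b ≠ x) (g φ : ℝ) :
    Commute (gammaOne x) (bondTerm g φ a b) := by
  have h1a : Commute (gammaOne x) (gammaOne a) := gammaOne_comm x a
  have h1b : Commute (gammaOne x) (gammaOne b) := gammaOne_comm x b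
  have h2a : Commute (gammaOne x) (gammaTwo a) := gammaOne_comm_gammaTwo_of_ne (Ne.symm ha)
  have h2b : Commute (gammaOne x) (gammaTwo b) := gammaOne_comm_gammaTwo_of_ne (Ne.symm hb)
  have hc : Commute (gammaOne x) ((φ : ℂ) • (1 : Matrix (Finset (Orb Λ)) (Finset (Orb Λ)) ℂ)) :=
    (Commute.one_right _).smul_right _
  unfold bondTerm
  exact (((((h1a.sub_right h1b).add_right hc).mul_right ((h1a.sub_right h1b).add_right hc)).add_right
    ((h2a.sub_right h2b).mul_right (h2a.sub_right h2b))).smul_right _)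

/-- The commutator of one bond term at `x` (field `0`): `[(g/8){[Γ¹_x-Γ¹_y]² + [Γ²_x-Γ²_y]²}, Γ¹_x] = (ig/2) Γ³_xΓ²_y`
for `y ≠ x`. [cite: Koma2022, (6.27)] -/
theorem bondTerm_comm_gammaOne {x y : Λ} (hxy : y ≠ x) (g : ℝ) :
    bondTerm g 0 x y * gammaOne x - gammaOne x * bondTerm g 0 x y =
      ((Complex.I * (g / 2 : ℝ)) : ℂ) • (gammaThree x * gammaTwo y) := by
  -- `[Γ¹_x - Γ¹_y]²` commutes with `Γ¹_x`
  have hA : Commute (gammaOne x) ((gammaOne x - gammaOne y + ((0 : ℝ) : ℂ) • 1) *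
      (gammaOne x - gammaOne y + ((0 : ℝ) : ℂ) • 1)) := by
    have h : Commute (gammaOne x) (gammaOne x - gammaOne y + ((0 : ℝ) : ℂ) • 1) :=
      ((Commute.refl _).sub_right (gammaOne_comm x y)).add_right ((Commute.one_right _).smul_right _)
    exact h.mul_right h
  -- `[D², Γ¹_x]` with `D = Γ²_x - Γ²_y`: `D[D,Γ¹] + [D,Γ¹]D`, `[D, Γ¹_x] = -[Γ¹_x,Γ²_x] = -2iΓ³_x·(-1)…`
  have hDx : (gammaTwo x - gammaTwo y) * gammaOne x - gammaOne x * (gammaTwo x - gammaTwo y) =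
      -(2 * Complex.I) • gammaThree x := by
    rw [Matrix.sub_mul, Matrix.mul_sub, gammaTwo_mul_gammaOne, gammaOne_mul_gammaTwo,
      gammaOne_comm_gammaTwo_of_ne (Ne.symm hxy)]
    module
  have hanti : (gammaTwo x - gammaTwo y) * gammaThree x + gammaThree x * (gammaTwo x - gammaTwo y) =
      -(2 : ℂ) • (gammaThree x * gammaTwo y) := by
    rw [Matrix.sub_mul, Matrix.mul_sub, gammaTwo_mul_gammaThree, gammaThree_mul_gammaTwo,
      ← gammaThree_comm_gammaTwo_of_ne (Ne.symm hxy)]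
    module
  have hD2 : (gammaTwo x - gammaTwo y) * (gammaTwo x - gammaTwo y) * gammaOne x -
      gammaOne x * ((gammaTwo x - gammaTwo y) * (gammaTwo x - gammaTwo y)) =
      (4 * Complex.I) • (gammaThree x * gammaTwo y) := by
    have e : (gammaTwo x - gammaTwo y) * (gammaTwo x - gammaTwo y) * gammaOne x -
        gammaOne x * ((gammaTwo x - gammaTwo y) * (gammaTwo x - gammaTwo y)) =
        (gammaTwo x - gammaTwo y) * ((gammaTwo x - gammaTwo y) * gammaOne x - gammaOne x * (gammaTwo x - gammaTwo y)) +
          ((gammaTwo x - gammaTwo y) * gammaOne x - gammaOne x * (gammaTwo x - gammaTwo y)) * (gammaTwo x - gammaTwo y) := by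
      noncomm_ring
    rw [e, hDx, Matrix.mul_smul, Matrix.smul_mul, ← smul_add, hanti, smul_smul]
    congr 1
    ring
  have hsplit : ∀ A D X : Matrix (Finset (Orb Λ)) (Finset (Orb Λ)) ℂ,
      (A + D) * X - X * (A + D) = (A * X - X * A) + (D * X - X * D) := by
    intros; noncomm_ring
  rw [bondTerm, Matrix.smul_mul, Matrix.mul_smul, ← smul_sub, hsplit, hA.symm.eq, sub_self, zero_add, hD2, smul_smul]
  congr 1
  push_cast
  ring

/-- **`[H_pair(g, 0), Γ¹_x] = ig Σ_{y∼x} Γ³_x Γ²_y`** (Lieb frame; Koma's (6.27) in real space, with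
his antiferromagnetic sign reversed by the sublattice rotation (6.5)). [cite: Koma2022, (6.27)] -/
theorem pairInteraction_comm_gammaOne (g : ℝ) (x : Λ) :
    pairInteraction G g (fun _ _ => 0) * gammaOne x - gammaOne x * pairInteraction G g (fun _ _ => 0) =
      ((Complex.I * g : ℂ)) • ∑ y : Λ, if G.Adj x y then gammaThree x * gammaTwo y else 0 := by
  unfold pairInteraction
  rw [Finset.sum_mul, Finset.mul_sum, ← Finset.sum_sub_distrib]
  simp only [Finset.sum_mul, Finset.mul_sum, ← Finset.sum_sub_distrib]
  rw [sum_sum_eq_cross (fun a b => (if G.Adj a b then bondTerm g 0 a b else 0) * gammaOne x -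
      gammaOne x * (if G.Adj a b then bondTerm g 0 a b else 0)) x]
  · rw [Finset.smul_sum]
    refine Finset.sum_congr rfl fun y _ => ?_
    by_cases hxy : G.Adj x y
    · have hyx : y ≠ x := fun h => G.irrefl (h ▸ hxy)
      rw [if_pos hxy, if_pos hxy.symm, if_pos hxy, show bondTerm g 0 y x = bondTerm g 0 x y by
        rw [bondTerm_swap g 0 y x, neg_zero], bondTerm_comm_gammaOne hyx, ← two_smul ℂ, smul_smul]
      congr 1
      push_cast
      ring
    · rw [if_neg hxy, if_neg (fun h => hxy h.symm), if_neg hxy, Matrix.zero_mul, Matrix.mul_zero, sub_zero,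
        add_zero, smul_zero]
  · intro a b ha hb
    split_ifs
    · exact sub_eq_zero.2 (commute_gammaOne_bondTerm ha hb g 0).eq.symm
    · rw [Matrix.zero_mul, Matrix.mul_zero, sub_zero]
  · rw [if_neg G.irrefl, Matrix.zero_mul, Matrix.mul_zero, sub_zero]

/-- **The local double commutator of the pair interaction**:
`[Γ¹_x, [H_pair(g,0), Γ¹_x]] = 2g Σ_{y∼x} Γ²_x Γ²_y` (Lieb frame). [cite: Koma2022, (6.28)–(6.29)] -/
theorem gammaOne_doubleComm_pairInteraction (g : ℝ) (x : Λ) :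
    gammaOne x * (pairInteraction G g (fun _ _ => 0) * gammaOne x - gammaOne x * pairInteraction G g (fun _ _ => 0)) -
        (pairInteraction G g (fun _ _ => 0) * gammaOne x - gammaOne x * pairInteraction G g (fun _ _ => 0)) * gammaOne x =
      ((2 * g : ℝ) : ℂ) • ∑ y : Λ, if G.Adj x y then gammaTwo x * gammaTwo y else 0 := by
  rw [pairInteraction_comm_gammaOne, Matrix.mul_smul, Matrix.smul_mul, ← smul_sub, Finset.mul_sum, Finset.sum_mul,
    ← Finset.sum_sub_distrib]
  have hpt : ∀ y : Λ, gammaOne x * (if G.Adj x y then gammaThree x * gammaTwo y else 0) -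
      (if G.Adj x y then gammaThree x * gammaTwo y else 0) * gammaOne x =
      if G.Adj x y then (-(2 * Complex.I)) • (gammaTwo x * gammaTwo y) else 0 := by
    intro y
    split_ifs with hxy
    · have hyx : y ≠ x := fun h => G.irrefl (h ▸ hxy)
      rw [← Matrix.mul_assoc, gammaOne_mul_gammaThree, Matrix.mul_assoc, ← gammaOne_comm_gammaTwo_of_ne (Ne.symm hyx),
        ← Matrix.mul_assoc, gammaThree_mul_gammaOne, Matrix.smul_mul, Matrix.smul_mul]
      module
    · rw [Matrix.mul_zero, Matrix.zero_mul, sub_zero]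
  simp only [hpt]
  rw [Finset.smul_sum, Finset.smul_sum]
  refine Finset.sum_congr rfl fun y _ => ?_
  split_ifs
  · rw [smul_smul]
    congr 1
    push_cast
    linear_combination (-2 * (g : ℂ)) * Complex.I_mul_I
  · rw [smul_zero, smul_zero]

/-! ### The on-site `U` term and the source term -/

/-- The on-site interaction `Σ_y (n_{y↑}-½)(n_{y↓}-½)` commutes with `Γ¹_x` (it is `½Σ_y[Γ¹_y]² - |Λ|/4`,
(3.7)). [cite: Koma2022, (3.7)] -/
theorem hubbardU_comm_gammaOne (x : Λ) :
    Commute (gammaOne x) (∑ y : Λ, (numberOp y 0 - (1 / 2 : ℂ) • 1) * (numberOp y 1 - (1 / 2 : ℂ) • 1)) := by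
  refine Commute.sum_right _ _ _ fun y _ => ?_
  have h : (numberOp y 0 - (1 / 2 : ℂ) • 1) * (numberOp y 1 - (1 / 2 : ℂ) • 1) =
      (1 / 2 : ℂ) • (gammaOne y * gammaOne y) - (1 / 4 : ℂ) • (1 : Matrix (Finset (Orb Λ)) (Finset (Orb Λ)) ℂ) := by
    rw [KomaPiFlux.gammaOne_mul_self_eq' y]
    module
  rw [h]
  have hc : Commute (gammaOne x) (gammaOne y) := gammaOne_comm x y
  exact ((hc.mul_right hc).smul_right _).sub_right ((Commute.one_right _).smul_right _)

/-- `[peierlsHubbard G T U, Γ¹_x] = [peierlsHubbard G T 0, Γ¹_x]`: the `U` term drops out.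
[cite: Koma2022, (3.7), (6.25)] -/
theorem peierlsHubbard_comm_gammaOne_eq (T : Fin 2 → Λ → Λ → ℂ) (U : ℝ) (x : Λ) :
    peierlsHubbard G T U * gammaOne x - gammaOne x * peierlsHubbard G T U =
      peierlsHubbard G T 0 * gammaOne x - gammaOne x * peierlsHubbard G T 0 := by
  rw [KomaPiFlux.peierlsHubbard_eq_add_U G T U, Matrix.add_mul, Matrix.mul_add, Matrix.smul_mul, Matrix.mul_smul,
    (hubbardU_comm_gammaOne x).eq]
  abel

/-- `[O, Γ¹_x] = -2iΓ³_x` for `O = Σ_y Γ²_y`. [cite: Koma2022, (3.8)] -/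
theorem orderParameter_comm_gammaOne (x : Λ) :
    (orderParameter : Matrix (Finset (Orb Λ)) (Finset (Orb Λ)) ℂ) * gammaOne x - gammaOne x * orderParameter =
      -(2 * Complex.I) • gammaThree x := by
  rw [orderParameter, Finset.sum_mul, Finset.mul_sum, ← Finset.sum_sub_distrib,
    Finset.sum_eq_single x, gammaTwo_mul_gammaOne, gammaOne_mul_gammaTwo]
  · module
  · intro y _ hyx
    rw [← gammaOne_comm_gammaTwo_of_ne (Ne.symm hyx), sub_self]
  · exact fun h => absurd (Finset.mem_univ x) h

/-- `[Γ¹_x, [O, Γ¹_x]] = -4Γ²_x`. [cite: Koma2022, (3.8), (3.10)] -/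
theorem gammaOne_doubleComm_orderParameter (x : Λ) :
    gammaOne x * ((orderParameter : Matrix (Finset (Orb Λ)) (Finset (Orb Λ)) ℂ) * gammaOne x - gammaOne x * orderParameter) -
        (orderParameter * gammaOne x - gammaOne x * orderParameter) * gammaOne x =
      -(4 : ℂ) • gammaTwo x := by
  rw [orderParameter_comm_gammaOne, Matrix.mul_smul, Matrix.smul_mul, gammaOne_mul_gammaThree, gammaThree_mul_gammaOne,
    smul_smul, smul_smul, ← sub_smul]
  congr 1
  rw [show -(2 * Complex.I) * -Complex.I - -(2 * Complex.I) * Complex.I = 4 * (Complex.I * Complex.I) by ring,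
    Complex.I_mul_I]
  ring

/-- **The local double commutator of the pair-hopping Hamiltonian** (field `0`):
`[Γ¹_x, [H, Γ¹_x]] = [Γ¹_x, [K(T), Γ¹_x]] + 2g Σ_{y∼x} Γ²_xΓ²_y + 4B Γ²_x` — the `U` term drops out,
the pair interaction gives (6.28)–(6.29), the source gives `4BΓ²_x`; the hopping part is Koma's (6.26).
[cite: Koma2022, (6.25)–(6.29)] -/
theorem gammaOne_doubleComm_hamiltonian (T : Fin 2 → Λ → Λ → ℂ) (U g B : ℝ) (x : Λ) :
    gammaOne x * (hamiltonian G T U g (fun _ _ => 0) B * gammaOne x - gammaOne x * hamiltonian G T U g (fun _ _ => 0) B) -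
        (hamiltonian G T U g (fun _ _ => 0) B * gammaOne x - gammaOne x * hamiltonian G T U g (fun _ _ => 0) B) *
          gammaOne x =
      (gammaOne x * (peierlsHubbard G T 0 * gammaOne x - gammaOne x * peierlsHubbard G T 0) -
          (peierlsHubbard G T 0 * gammaOne x - gammaOne x * peierlsHubbard G T 0) * gammaOne x) +
        ((2 * g : ℝ) : ℂ) • (∑ y : Λ, if G.Adj x y then gammaTwo x * gammaTwo y else 0) +
        ((4 * B : ℝ) : ℂ) • gammaTwo x := by
  have hK := peierlsHubbard_comm_gammaOne_eq G T U x
  have hP := gammaOne_doubleComm_pairInteraction G g x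
  have hO := gammaOne_doubleComm_orderParameter (Λ := Λ) x
  -- split the commutator `[H, Γ¹]` into its three parts
  have hsplit : hamiltonian G T U g (fun _ _ => 0) B * gammaOne x - gammaOne x * hamiltonian G T U g (fun _ _ => 0) B =
      (peierlsHubbard G T 0 * gammaOne x - gammaOne x * peierlsHubbard G T 0) +
        (pairInteraction G g (fun _ _ => 0) * gammaOne x - gammaOne x * pairInteraction G g (fun _ _ => 0)) -
        (B : ℂ) • ((orderParameter : Matrix (Finset (Orb Λ)) (Finset (Orb Λ)) ℂ) * gammaOne x - gammaOne x * orderParameter) := by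
    rw [hamiltonian, Matrix.sub_mul, Matrix.add_mul, Matrix.mul_sub, Matrix.mul_add, Matrix.smul_mul, Matrix.mul_smul,
      smul_sub, ← hK]
    abel
  have halg : ∀ (X K P O : Matrix (Finset (Orb Λ)) (Finset (Orb Λ)) ℂ) (b : ℂ),
      X * (K + P - b • O) - (K + P - b • O) * X = (X * K - K * X) + (X * P - P * X) - b • (X * O - O * X) := by
    intros
    simp only [Matrix.mul_add, Matrix.mul_sub, Matrix.add_mul, Matrix.sub_mul, Matrix.mul_smul, Matrix.smul_mul, smul_sub]
    abel
  rw [hsplit, halg, hP, hO]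
  push_cast
  module

end Graph

end PairHopRP

end Literature.MathematicalPhysics.QuantumLattice

end
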